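import Summits.QuantumFields.YangMills.Theorems.UnitScaleTiltProp7HermiteCornerBlendEnergy
import HarnessLib

/-!
# Route `UnitScaleTilt`, crux K1 «MinimiserStabilityRegPr» (stmt-QuantumFields-19200), route-R E′ path (α′), row LEMMA-H-CURVED — FILE 9a (abstract, K-form-ready slack):
# THE BLEND `Φ(x) = Σ_y W_y(x)·Ψ_y(x)` OF ARBITRARY LOCAL MODELS — its covariant Laplacian term by term, the master pointwise bound, and the Laplacian ENERGY with the
# two slack groups kept as the LOCAL MODELS' OWN covariant Laplacian ∕ Dirichlet energies (nothing about a local model is estimated by its size)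

Cell `ym3-torus`, D-0154 (3c) twin-width seat `ym-routeR-w1` (gen 6); row "routeR-w1: LEMMA-H-CURVED" (namer ★ym-ust-19200-p1 g14∕g15; design of record (x2′-corner)),
answering the namer's located objection to F-H5b (bus 2026-08-28 20:03Z: the `Σ_y‖ψ̊(embIter y)‖²` slack of ✓ `Prop7LemmaHCurvedOfRows.lemmaH_curved_of_rows` is
alignment-blind; a form the consumer can book in `K`-currency is wanted).  THEOREMS ONLY (0 `def`, 0 `sorry`); `--supports stmt-QuantumFields-19200`, count-neutral.
YM₃ on T³ is a ladder rung (R3), not the Clay problem; nothing here claims a stub, the crux, d = 4 or the mass gap.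

WHY.  In the landed chain F-H3β (✓ `Prop7HermiteCornerBlendCov`) → F-H4 (✓ `Prop7HermiteCornerBlendEnergy`) → F-H5a∕b the local model near the centre `y` is the
frame-transported constant `z ↦ R(P_y z)m_y`, and F-H4 §2–§3 is the ONLY place where such a field is estimated by its size (`‖D_U(R(P_y·)m_y)‖ ≤ 2‖h − 1‖·‖m_y − c_y‖`),
which is where the alignment-blind slack is born.  Upstream of that step nothing about the local model is used except the scalar-weight Leibniz rule
✓ `Prop7ConjFrameTransport.divB_covD_smul_fun`.  THIS FILE redoes F-H3β §2–§4 and F-H4 §4 for ARBITRARY local models `Ψ : Y → S → 𝔸` and stops BEFORE any size estimate: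
* §1 ★ `lap_localBlend_eq` (the three groups, exact) and ★★ `norm_lap_localBlend_le` (master pointwise bound, any recentring `Z_μ(x)`, partition of unity);
* §2 the scalar energies with SITE-DEPENDENT entries: `energy_main_local` (Jensen in `y`: `Σ_z(Σ_y W_y(z)b_y(z))² ≤ Σ_zΣ_y W_y(z)b_y(z)²` — no column mass needed),
  `energy_grad_local` (weighted Cauchy–Schwarz with the `y`-mass `G₁` only); group (i) is F-H4's ✓ `energy_second` verbatim;
* §3 ★★★ `sum_sq_norm_lap_localBlend_le`:
  `Σ_z‖Δ_UΦ(z)‖² ≤ 3·Σ_zΣ_y W_y(z)‖Δ_UΨ_y(z)‖² + 3·(2|ι|G₁)·Σ_zΣ_yΣ_μ(|∂⁻_μW_y(z)|‖D*_UΨ_y(z,μ)‖² + |∂⁺_μW_y(z)|‖D_UΨ_y(z,μ)‖²) + 3|ι|²G₂K₂·Σ_yG_y²`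
  (data row `‖Ψ_y(z) − Z_μ(z)‖ ≤ G_y` on a support predicate `N` off which `W_y` vanishes at `z, z ± e_μ`), and ★★ `sum_sq_norm_lap_localBlend_le_supp`: the same with the
  weights ELIMINATED by `0 ≤ W_y ≤ 1`, `|∂_μW_y| ≤ g₁` — the slack is `3·Σ_y Σ_{z : N y z}‖Δ_UΨ_y(z)‖² + 6|ι|G₁g₁·Σ_y Σ_{z : N y z}Σ_μ(‖D*_UΨ_y(z,μ)‖² + ‖D_UΨ_y(z,μ)‖²)`.
No bi-contraction of `U`, no frame, no frame row is used: the consumer chooses the local models (frame transports recover F-H4∕F-H5b; `U`-parallel transports along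
coordinate combs turn `D_UΨ_y` into conjugated commutators `[hol_U(loop), Ψ_y(centre)]` and `Δ_UΨ_y` into sums of differences of such at adjacent bonds — commutator
currency, vanishing on aligned data; a sum `Ψ_y = χ + Ψ′_y` with one GLOBAL field `χ` (e.g. a spectrally slow part, ✓ `Prop7SpectralSplit`) charges `χ` only through its
own `‖Δ_Uχ‖²` and Dirichlet energy near each centre, and `χ` drops out of the data row for the recentring `Z_μ(z) := χ(z) + Z′_μ(z)`).
HONEST SCOPE.  Pure algebra, triangle and Cauchy–Schwarz inequalities; no weight row beyond the displayed ones, no background hypothesis is used or asserted here.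

References: T. Bałaban, CMP 99 (1985) 389–434 [Balaban1985BackgroundPropagators] ((3.3)–(3.4) pp.390–391, (3.8) p.392, Thm 3.11 p.416); CMP 95 (1984) 17–40
[Balaban1984PropagatorsI] ((1.18) p.20, (1.29)–(1.31) p.23).
-/

set_option autoImplicit false

noncomputable section

open scoped BigOperators

namespace Summit.QuantumFields.YangMills.Theorems.Prop7LocalModelBlend

open Literature.MathematicalPhysics.QuantumFieldTheory.Balaban1983to89
open B9Eq39Adjoint (R covD covDstar divB)
open Summit.QuantumFields.YangMills.Theorems.Prop7ConjFrameTransport (divB_covD_smul_fun)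
open Summit.QuantumFields.YangMills.Theorems.Prop7HermiteCornerBlendCov (divB_covD_finset_sum sum_secondDiff_weight_eq_zero sum_secondDiff_smul_recenter)
open Summit.QuantumFields.YangMills.Theorems.Prop7HermiteCornerBlendEnergy (jensen_sq energy_second)

/-! ## §1 The covariant Laplacian of the local-model blend and the master pointwise bound -/

section Leibniz

variable {𝔸 : Type*} [Ring 𝔸] [Algebra ℝ 𝔸] {S : Type*} {ι : Type*} [Fintype ι] (T : ι → Equiv.Perm S) (U : ι → S → 𝔸ˣ)
  {Y : Type*} [Fintype Y]

/-- ★ **THE COVARIANT LAPLACIAN OF THE LOCAL-MODEL BLEND**: for weights `W : Y → S → ℝ`, local models `Ψ : Y → S → 𝔸` and `Φ = Σ_y W_y·Ψ_y`,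
`Δ_UΦ(x) = Σ_y W_y(x)·Δ_UΨ_y(x) + Σ_y Σ_μ[(∂⁻_μW_y)(x)·D*_μΨ_y(x) − (∂⁺_μW_y)(x)·D_μΨ_y(x)] − Σ_y Σ_μ (Δ²_μW_y)(x)·Ψ_y(x)`
(`∂⁺_μw(x) = w(x+e_μ) − w(x)`, `∂⁻_μw(x) = w(x) − w(x−e_μ)`, `Δ²_μ = ∂⁺_μ − ∂⁻_μ`). [cite: Balaban1985BackgroundPropagators, (3.3)-(3.4) pp.390-391, (3.8) p.392] -/
theorem lap_localBlend_eq (W : Y → S → ℝ) (Ψ : Y → S → 𝔸) (x : S) :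
    divB T U (fun μ => covD T U μ (fun z => ∑ y, W y z • Ψ y z)) x
      = ∑ y, W y x • divB T U (fun μ => covD T U μ (Ψ y)) x
        + ∑ y, ∑ μ, ((W y x - W y ((T μ).symm x)) • covDstar T U μ (Ψ y) x
            - (W y (T μ x) - W y x) • covD T U μ (Ψ y) x)
        - ∑ y, ∑ μ, ((W y (T μ x) - W y x) - (W y x - W y ((T μ).symm x))) • Ψ y x := by
  rw [divB_covD_finset_sum T U Finset.univ (fun y z => W y z • Ψ y z) x,
    Finset.sum_congr rfl (fun y _ => divB_covD_smul_fun T U (W y) (Ψ y) x),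
    ← Finset.sum_add_distrib, ← Finset.sum_sub_distrib]
  refine Finset.sum_congr rfl fun y _ => ?_
  rw [Finset.sum_sub_distrib (f := fun μ => (W y x - W y ((T μ).symm x)) • covDstar T U μ (Ψ y) x
      - (W y (T μ x) - W y x) • covD T U μ (Ψ y) x)]
  abel

end Leibniz

section Master

variable {𝔸 : Type*} [NormedRing 𝔸] [NormedAlgebra ℝ 𝔸] {S : Type*} {ι : Type*} [Fintype ι] (T : ι → Equiv.Perm S) (U : ι → S → 𝔸ˣ)
  {Y : Type*} [Fintype Y]

/-- ★★ **MASTER POINTWISE BOUND FOR THE LOCAL-MODEL BLEND** (partition of unity `Σ_yW_y ≡ 1`, any recentring `Z_μ`):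
`‖Δ_UΦ(x)‖ ≤ Σ_y|W_y(x)|·‖Δ_UΨ_y(x)‖ + Σ_yΣ_μ(|∂⁻_μW_y(x)|·‖D*_μΨ_y(x)‖ + |∂⁺_μW_y(x)|·‖D_μΨ_y(x)‖) + Σ_μΣ_y|Δ²_μW_y(x)|·‖Ψ_y(x) − Z_μ‖`.
[cite: Balaban1985BackgroundPropagators, (3.3)-(3.4) pp.390-391, (3.8) p.392] -/
theorem norm_lap_localBlend_le (W : Y → S → ℝ) (hW : ∀ z : S, ∑ y, W y z = 1) (Ψ : Y → S → 𝔸) (x : S) (Z : ι → 𝔸) :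
    ‖divB T U (fun μ => covD T U μ (fun z => ∑ y, W y z • Ψ y z)) x‖
      ≤ ∑ y, |W y x| * ‖divB T U (fun μ => covD T U μ (Ψ y)) x‖
        + ∑ y, ∑ μ, (|W y x - W y ((T μ).symm x)| * ‖covDstar T U μ (Ψ y) x‖
            + |W y (T μ x) - W y x| * ‖covD T U μ (Ψ y) x‖)
        + ∑ μ, ∑ y, |(W y (T μ x) - W y x) - (W y x - W y ((T μ).symm x))| * ‖Ψ y x - Z μ‖ := by
  rw [lap_localBlend_eq T U W Ψ x]
  -- recentre the undifferentiated group direction by direction, using `Σ_y Δ²_μW_y(x) = 0`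
  have hmain : ∑ y, ∑ μ, ((W y (T μ x) - W y x) - (W y x - W y ((T μ).symm x))) • Ψ y x
      = ∑ μ, ∑ y, ((W y (T μ x) - W y x) - (W y x - W y ((T μ).symm x))) • (Ψ y x - Z μ) := by
    rw [Finset.sum_comm]
    refine Finset.sum_congr rfl fun μ _ => ?_
    exact sum_secondDiff_smul_recenter _ (sum_secondDiff_weight_eq_zero W hW x (T μ x) ((T μ).symm x)) (fun y => Ψ y x) (Z μ)
  rw [hmain]
  refine (norm_sub_le _ _).trans (add_le_add ((norm_add_le _ _).trans (add_le_add ?_ ?_)) ?_)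
  · refine (norm_sum_le _ _).trans (Finset.sum_le_sum fun y _ => ?_)
    rw [norm_smul, Real.norm_eq_abs]
  · refine (norm_sum_le _ _).trans (Finset.sum_le_sum fun y _ => (norm_sum_le _ _).trans (Finset.sum_le_sum fun μ _ => ?_))
    refine (norm_sub_le _ _).trans (add_le_add ?_ ?_)
    · rw [norm_smul, Real.norm_eq_abs]
    · rw [norm_smul, Real.norm_eq_abs]
  · refine (norm_sum_le _ _).trans (Finset.sum_le_sum fun μ _ => (norm_sum_le _ _).trans (Finset.sum_le_sum fun y _ => ?_))
    rw [norm_smul, Real.norm_eq_abs]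

/-- the master bound with the data row on a support predicate `N` (off which `W_y` vanishes at `x` and `x ± e_μ`) and non-negative weights:
`‖Δ_UΦ(x)‖ ≤ Σ_y W_y(x)‖Δ_UΨ_y(x)‖ + Σ_yΣ_μ(|∂⁻_μW_y(x)|‖D*_μΨ_y(x)‖ + |∂⁺_μW_y(x)|‖D_μΨ_y(x)‖) + Σ_μΣ_y|Δ²_μW_y(x)|·G_y`.
[cite: Balaban1985BackgroundPropagators, (3.3)-(3.4) pp.390-391] -/
theorem norm_lap_localBlend_le_rows (W : Y → S → ℝ) (hW1 : ∀ z : S, ∑ y, W y z = 1) (hW0 : ∀ y z, 0 ≤ W y z) (Ψ : Y → S → 𝔸)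
    (N : Y → S → Prop) (hN : ∀ y z, ¬ N y z → W y z = 0 ∧ (∀ μ, W y (T μ z) = 0) ∧ (∀ μ, W y ((T μ).symm z) = 0))
    (x : S) (Z : ι → 𝔸) (G : Y → ℝ) (hG : ∀ y, N y x → ∀ μ, ‖Ψ y x - Z μ‖ ≤ G y) :
    ‖divB T U (fun μ => covD T U μ (fun z => ∑ y, W y z • Ψ y z)) x‖
      ≤ ∑ y, W y x * ‖divB T U (fun μ => covD T U μ (Ψ y)) x‖
        + ∑ y, ∑ μ, (|W y x - W y ((T μ).symm x)| * ‖covDstar T U μ (Ψ y) x‖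
            + |W y (T μ x) - W y x| * ‖covD T U μ (Ψ y) x‖)
        + ∑ μ, ∑ y, |(W y (T μ x) - W y x) - (W y x - W y ((T μ).symm x))| * G y := by
  refine (norm_lap_localBlend_le T U W hW1 Ψ x Z).trans (add_le_add (add_le_add (le_of_eq ?_) le_rfl) ?_)
  · exact Finset.sum_congr rfl fun y _ => by rw [abs_of_nonneg (hW0 y x)]
  · refine Finset.sum_le_sum fun μ _ => Finset.sum_le_sum fun y _ => ?_
    by_cases hn : N y x
    · exact mul_le_mul_of_nonneg_left (hG y hn μ) (abs_nonneg _)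
    · obtain ⟨h0, hp, hm⟩ := hN y x hn
      rw [h0, hp μ, hm μ]; simp

end Master

/-! ## §2 Scalar energies with site-dependent entries -/

section Energy

variable {S : Type*} [Fintype S] {ι : Type*} [Fintype ι] (T : ι → Equiv.Perm S) {Y : Type*} [Fintype Y]

/-- energy of the main group with SITE-DEPENDENT entries (Jensen in `y`, no column mass): `Σ_z (Σ_y W_y(z)·b_y(z))² ≤ Σ_z Σ_y W_y(z)·b_y(z)²`. [folklore] -/
theorem energy_main_local (W : Y → S → ℝ) (hW1 : ∀ z : S, ∑ y, W y z = 1) (hW0 : ∀ y z, 0 ≤ W y z) (b : Y → S → ℝ) :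
    ∑ z, (∑ y, W y z * b y z) ^ 2 ≤ ∑ z, ∑ y, W y z * b y z ^ 2 :=
  Finset.sum_le_sum fun z _ => jensen_sq (fun y => W y z) (fun y => b y z) (fun y => hW0 y z) (hW1 z)

/-- `(a·p + b·q)² ≤ (a + b)·(a·p² + b·q²)` for `a, b ≥ 0`. [folklore] -/
theorem sq_wadd_le {a b p q : ℝ} (ha : 0 ≤ a) (hb : 0 ≤ b) : (a * p + b * q) ^ 2 ≤ (a + b) * (a * p ^ 2 + b * q ^ 2) := by
  nlinarith [mul_nonneg (mul_nonneg ha hb) (sq_nonneg (p - q))]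

/-- energy of the gradient group with SITE-DEPENDENT entries (weighted Cauchy–Schwarz in `(y, μ)` with the `y`-mass `G₁` of the weight gradients):
`Σ_z (Σ_yΣ_μ (|∂⁻_μW_y(z)|·p + |∂⁺_μW_y(z)|·q))² ≤ 2|ι|G₁·Σ_zΣ_yΣ_μ (|∂⁻_μW_y(z)|·p² + |∂⁺_μW_y(z)|·q²)`. [folklore] -/
theorem energy_grad_local (W : Y → S → ℝ) (G₁ : ℝ) (hM1 : ∀ (z : S) (μ : ι), ∑ y, |W y (T μ z) - W y z| ≤ G₁) (p q : Y → ι → S → ℝ) :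
    ∑ z, (∑ y, ∑ μ, (|W y z - W y ((T μ).symm z)| * p y μ z + |W y (T μ z) - W y z| * q y μ z)) ^ 2
      ≤ 2 * (Fintype.card ι : ℝ) * G₁
        * ∑ z, ∑ y, ∑ μ, (|W y z - W y ((T μ).symm z)| * p y μ z ^ 2 + |W y (T μ z) - W y z| * q y μ z ^ 2) := by
  rw [Finset.mul_sum]
  refine Finset.sum_le_sum fun z _ => ?_
  -- Cauchy–Schwarz over the index `(y, μ)`
  have cs : (∑ y, ∑ μ, (|W y z - W y ((T μ).symm z)| * p y μ z + |W y (T μ z) - W y z| * q y μ z)) ^ 2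
      ≤ (∑ y, ∑ μ, (|W y z - W y ((T μ).symm z)| + |W y (T μ z) - W y z|))
        * ∑ y, ∑ μ, (|W y z - W y ((T μ).symm z)| * p y μ z ^ 2 + |W y (T μ z) - W y z| * q y μ z ^ 2) := by
    rw [← Fintype.sum_prod_type' (fun y μ => |W y z - W y ((T μ).symm z)| * p y μ z + |W y (T μ z) - W y z| * q y μ z),
      ← Fintype.sum_prod_type' (fun y μ => |W y z - W y ((T μ).symm z)| + |W y (T μ z) - W y z|),
      ← Fintype.sum_prod_type' (fun y μ => |W y z - W y ((T μ).symm z)| * p y μ z ^ 2 + |W y (T μ z) - W y z| * q y μ z ^ 2)]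
    exact Finset.sum_sq_le_sum_mul_sum_of_sq_le_mul Finset.univ (fun i _ => add_nonneg (abs_nonneg _) (abs_nonneg _))
      (fun i _ => add_nonneg (mul_nonneg (abs_nonneg _) (sq_nonneg _)) (mul_nonneg (abs_nonneg _) (sq_nonneg _)))
      fun i _ => sq_wadd_le (abs_nonneg _) (abs_nonneg _)
  have mass : ∑ y, ∑ μ, (|W y z - W y ((T μ).symm z)| + |W y (T μ z) - W y z|) ≤ 2 * (Fintype.card ι : ℝ) * G₁ := by
    rw [Finset.sum_comm]
    have hμ : ∀ μ : ι, ∑ y, (|W y z - W y ((T μ).symm z)| + |W y (T μ z) - W y z|) ≤ G₁ + G₁ := by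
      intro μ
      rw [Finset.sum_add_distrib]
      refine add_le_add ?_ (hM1 z μ)
      have e := hM1 ((T μ).symm z) μ
      simp only [Equiv.apply_symm_apply] at e
      exact e
    calc ∑ μ, ∑ y, (|W y z - W y ((T μ).symm z)| + |W y (T μ z) - W y z|) ≤ ∑ _μ : ι, (G₁ + G₁) := Finset.sum_le_sum fun μ _ => hμ μ
      _ = 2 * (Fintype.card ι : ℝ) * G₁ := by rw [Finset.sum_const, Finset.card_univ, nsmul_eq_mul]; ring
  exact cs.trans (mul_le_mul_of_nonneg_right mass (Finset.sum_nonneg fun y _ => Finset.sum_nonneg fun μ _ =>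
    add_nonneg (mul_nonneg (abs_nonneg _) (sq_nonneg _)) (mul_nonneg (abs_nonneg _) (sq_nonneg _))))

end Energy

/-! ## §3 The Laplacian energy of the local-model blend -/

section Main

variable {𝔸 : Type*} [NormedRing 𝔸] [NormedAlgebra ℝ 𝔸] {S : Type*} [Fintype S] {ι : Type*} [Fintype ι] (T : ι → Equiv.Perm S) (U : ι → S → 𝔸ˣ)
  {Y : Type*} [Fintype Y]

/-- ★★★ **THE LAPLACIAN ENERGY OF THE LOCAL-MODEL BLEND, SLACK UN-ESTIMATED**: for weights `W ≥ 0` with `Σ_y W_y ≡ 1`, weight-gradient `y`-mass `G₁`, weight second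
differences with `y`-mass `G₂` and column mass `K₂`, ANY local models `Ψ_y`, and a data row `‖Ψ_y(z) − Z_μ(z)‖ ≤ G_y` on the support predicate `N`,
`Σ_z‖Δ_UΦ(z)‖² ≤ 3·Σ_zΣ_y W_y(z)‖Δ_UΨ_y(z)‖² + 3·(2|ι|G₁)·Σ_zΣ_yΣ_μ(|∂⁻_μW_y(z)|‖D*_μΨ_y(z)‖² + |∂⁺_μW_y(z)|‖D_μΨ_y(z)‖²) + 3|ι|²G₂K₂·Σ_y G_y²`.
[cite: Balaban1985BackgroundPropagators, (3.3)-(3.4) pp.390-391, (3.8) p.392, Thm 3.11 p.416] -/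
theorem sum_sq_norm_lap_localBlend_le
    (W : Y → S → ℝ) (hW1 : ∀ z : S, ∑ y, W y z = 1) (hW0 : ∀ y z, 0 ≤ W y z) (Ψ : Y → S → 𝔸)
    (N : Y → S → Prop) (hN : ∀ y z, ¬ N y z → W y z = 0 ∧ (∀ μ, W y (T μ z) = 0) ∧ (∀ μ, W y ((T μ).symm z) = 0))
    (Z : ι → S → 𝔸) (G : Y → ℝ) (hG : ∀ y z, N y z → ∀ μ, ‖Ψ y z - Z μ z‖ ≤ G y)
    (G₁ G₂ K₂ : ℝ) (hG₂ : 0 ≤ G₂)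
    (hM1 : ∀ (z : S) (μ : ι), ∑ y, |W y (T μ z) - W y z| ≤ G₁)
    (hM2 : ∀ (z : S) (μ : ι), ∑ y, |(W y (T μ z) - W y z) - (W y z - W y ((T μ).symm z))| ≤ G₂)
    (hK2 : ∀ (y : Y) (μ : ι), ∑ z, |(W y (T μ z) - W y z) - (W y z - W y ((T μ).symm z))| ≤ K₂) :
    ∑ z, ‖divB T U (fun μ => covD T U μ (fun z' => ∑ y, W y z' • Ψ y z')) z‖ ^ 2
      ≤ 3 * ∑ z, ∑ y, W y z * ‖divB T U (fun μ => covD T U μ (Ψ y)) z‖ ^ 2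
        + 3 * (2 * (Fintype.card ι : ℝ) * G₁)
          * ∑ z, ∑ y, ∑ μ, (|W y z - W y ((T μ).symm z)| * ‖covDstar T U μ (Ψ y) z‖ ^ 2 + |W y (T μ z) - W y z| * ‖covD T U μ (Ψ y) z‖ ^ 2)
        + 3 * (Fintype.card ι : ℝ) ^ 2 * G₂ * K₂ * ∑ y, G y ^ 2 := by
  have h3 : ∀ a b e : ℝ, (a + b + e) ^ 2 ≤ 3 * (a ^ 2 + b ^ 2 + e ^ 2) := fun a b e => by
    nlinarith [sq_nonneg (a - b), sq_nonneg (b - e), sq_nonneg (a - e)]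
  have hpt := fun z : S => norm_lap_localBlend_le_rows T U W hW1 hW0 Ψ N hN z (fun μ => Z μ z) G (fun y hn μ => hG y z hn μ)
  have hsq : ∀ z : S, ‖divB T U (fun μ => covD T U μ (fun z' => ∑ y, W y z' • Ψ y z')) z‖ ^ 2
      ≤ 3 * ((∑ y, W y z * ‖divB T U (fun μ => covD T U μ (Ψ y)) z‖) ^ 2
        + (∑ y, ∑ μ, (|W y z - W y ((T μ).symm z)| * ‖covDstar T U μ (Ψ y) z‖ + |W y (T μ z) - W y z| * ‖covD T U μ (Ψ y) z‖)) ^ 2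
        + (∑ μ, ∑ y, |(W y (T μ z) - W y z) - (W y z - W y ((T μ).symm z))| * G y) ^ 2) :=
    fun z => (pow_le_pow_left₀ (norm_nonneg _) (hpt z) 2).trans (h3 _ _ _)
  have eA := energy_main_local W hW1 hW0 (fun y z => ‖divB T U (fun μ => covD T U μ (Ψ y)) z‖)
  have eB := energy_grad_local T W G₁ hM1 (fun y μ z => ‖covDstar T U μ (Ψ y) z‖) (fun y μ z => ‖covD T U μ (Ψ y) z‖)
  have eC := energy_second T W G₂ K₂ hG₂ hM2 hK2 G
  calc ∑ z, ‖divB T U (fun μ => covD T U μ (fun z' => ∑ y, W y z' • Ψ y z')) z‖ ^ 2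
      ≤ ∑ z, 3 * ((∑ y, W y z * ‖divB T U (fun μ => covD T U μ (Ψ y)) z‖) ^ 2
        + (∑ y, ∑ μ, (|W y z - W y ((T μ).symm z)| * ‖covDstar T U μ (Ψ y) z‖ + |W y (T μ z) - W y z| * ‖covD T U μ (Ψ y) z‖)) ^ 2
        + (∑ μ, ∑ y, |(W y (T μ z) - W y z) - (W y z - W y ((T μ).symm z))| * G y) ^ 2) := Finset.sum_le_sum fun z _ => hsq z
    _ = 3 * ∑ z, (∑ y, W y z * ‖divB T U (fun μ => covD T U μ (Ψ y)) z‖) ^ 2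
        + 3 * ∑ z, (∑ y, ∑ μ, (|W y z - W y ((T μ).symm z)| * ‖covDstar T U μ (Ψ y) z‖ + |W y (T μ z) - W y z| * ‖covD T U μ (Ψ y) z‖)) ^ 2
        + 3 * ∑ z, (∑ μ, ∑ y, |(W y (T μ z) - W y z) - (W y z - W y ((T μ).symm z))| * G y) ^ 2 := by
        rw [Finset.mul_sum, Finset.mul_sum, Finset.mul_sum, ← Finset.sum_add_distrib, ← Finset.sum_add_distrib]
        exact Finset.sum_congr rfl fun z _ => by ring
    _ ≤ 3 * ∑ z, ∑ y, W y z * ‖divB T U (fun μ => covD T U μ (Ψ y)) z‖ ^ 2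
        + 3 * ((2 * (Fintype.card ι : ℝ) * G₁)
          * ∑ z, ∑ y, ∑ μ, (|W y z - W y ((T μ).symm z)| * ‖covDstar T U μ (Ψ y) z‖ ^ 2 + |W y (T μ z) - W y z| * ‖covD T U μ (Ψ y) z‖ ^ 2))
        + 3 * ((Fintype.card ι : ℝ) ^ 2 * G₂ * K₂ * ∑ y, G y ^ 2) :=
        add_le_add (add_le_add (mul_le_mul_of_nonneg_left eA (by norm_num)) (mul_le_mul_of_nonneg_left eB (by norm_num)))
          (mul_le_mul_of_nonneg_left eC (by norm_num))
    _ = _ := by ring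

/-- ★★ **THE SAME WITH THE WEIGHTS ELIMINATED ON THE SUPPORT**: if moreover `W_y ≤ 1` and `|∂_μW_y| ≤ g₁` pointwise, the two slack groups are supported sums of the local
models' own covariant Laplacian and Dirichlet energies:
`Σ_z‖Δ_UΦ(z)‖² ≤ 3·Σ_yΣ_{z : N y z}‖Δ_UΨ_y(z)‖² + 3·(2|ι|G₁)·g₁·Σ_yΣ_{z : N y z}Σ_μ(‖D*_μΨ_y(z)‖² + ‖D_μΨ_y(z)‖²) + 3|ι|²G₂K₂·Σ_y G_y²`.
[cite: Balaban1985BackgroundPropagators, (3.3)-(3.4) pp.390-391, Thm 3.11 p.416; Balaban1984PropagatorsI, (1.29)-(1.31) p.23] -/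
theorem sum_sq_norm_lap_localBlend_le_supp
    (W : Y → S → ℝ) (hW1 : ∀ z : S, ∑ y, W y z = 1) (hW0 : ∀ y z, 0 ≤ W y z) (hWle : ∀ y z, W y z ≤ 1) (Ψ : Y → S → 𝔸)
    (N : Y → S → Prop) [∀ y z, Decidable (N y z)]
    (hN : ∀ y z, ¬ N y z → W y z = 0 ∧ (∀ μ, W y (T μ z) = 0) ∧ (∀ μ, W y ((T μ).symm z) = 0))
    (Z : ι → S → 𝔸) (G : Y → ℝ) (hG : ∀ y z, N y z → ∀ μ, ‖Ψ y z - Z μ z‖ ≤ G y)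
    (g₁ G₁ G₂ K₂ : ℝ) (hG₁ : 0 ≤ G₁) (hG₂ : 0 ≤ G₂)
    (hg₁ : ∀ (y : Y) (z : S) (μ : ι), |W y (T μ z) - W y z| ≤ g₁)
    (hM1 : ∀ (z : S) (μ : ι), ∑ y, |W y (T μ z) - W y z| ≤ G₁)
    (hM2 : ∀ (z : S) (μ : ι), ∑ y, |(W y (T μ z) - W y z) - (W y z - W y ((T μ).symm z))| ≤ G₂)
    (hK2 : ∀ (y : Y) (μ : ι), ∑ z, |(W y (T μ z) - W y z) - (W y z - W y ((T μ).symm z))| ≤ K₂) :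
    ∑ z, ‖divB T U (fun μ => covD T U μ (fun z' => ∑ y, W y z' • Ψ y z')) z‖ ^ 2
      ≤ 3 * ∑ y, ∑ z, (if N y z then ‖divB T U (fun μ => covD T U μ (Ψ y)) z‖ ^ 2 else 0)
        + 3 * (2 * (Fintype.card ι : ℝ) * G₁) * g₁
          * ∑ y, ∑ z, (if N y z then ∑ μ, (‖covDstar T U μ (Ψ y) z‖ ^ 2 + ‖covD T U μ (Ψ y) z‖ ^ 2) else 0)
        + 3 * (Fintype.card ι : ℝ) ^ 2 * G₂ * K₂ * ∑ y, G y ^ 2 := by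
  have main := sum_sq_norm_lap_localBlend_le T U W hW1 hW0 Ψ N hN Z G hG G₁ G₂ K₂ hG₂ hM1 hM2 hK2
  refine main.trans (add_le_add (add_le_add ?_ ?_) le_rfl)
  · -- main group: `W_y(z) ≤ 1` on `N`, `W_y(z) = 0` off `N`
    rw [Finset.sum_comm]
    refine mul_le_mul_of_nonneg_left (Finset.sum_le_sum fun y _ => Finset.sum_le_sum fun z _ => ?_) (by norm_num)
    by_cases hn : N y z
    · rw [if_pos hn]
      exact (mul_le_mul_of_nonneg_right (hWle y z) (sq_nonneg _)).trans (le_of_eq (one_mul _))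
    · rw [if_neg hn, (hN y z hn).1, zero_mul]
  · -- gradient group: `|∂W_y(z)| ≤ g₁` on `N`, `= 0` off `N`
    have hc : 0 ≤ 3 * (2 * (Fintype.card ι : ℝ) * G₁) := by positivity
    calc 3 * (2 * (Fintype.card ι : ℝ) * G₁)
          * ∑ z, ∑ y, ∑ μ, (|W y z - W y ((T μ).symm z)| * ‖covDstar T U μ (Ψ y) z‖ ^ 2 + |W y (T μ z) - W y z| * ‖covD T U μ (Ψ y) z‖ ^ 2)
        ≤ 3 * (2 * (Fintype.card ι : ℝ) * G₁)
          * (g₁ * ∑ y, ∑ z, (if N y z then ∑ μ, (‖covDstar T U μ (Ψ y) z‖ ^ 2 + ‖covD T U μ (Ψ y) z‖ ^ 2) else 0)) :=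
          mul_le_mul_of_nonneg_left ?_ hc
      _ = _ := by ring
    rw [Finset.sum_comm, Finset.mul_sum]
    refine Finset.sum_le_sum fun y _ => ?_
    rw [Finset.mul_sum]
    refine Finset.sum_le_sum fun z _ => ?_
    by_cases hn : N y z
    · rw [if_pos hn, Finset.mul_sum]
      refine Finset.sum_le_sum fun μ _ => ?_
      have a1 : |W y z - W y ((T μ).symm z)| ≤ g₁ := by
        have e := hg₁ y ((T μ).symm z) μ
        simp only [Equiv.apply_symm_apply] at e
        exact e
      have a2 : |W y (T μ z) - W y z| ≤ g₁ := hg₁ y z μ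
      calc |W y z - W y ((T μ).symm z)| * ‖covDstar T U μ (Ψ y) z‖ ^ 2 + |W y (T μ z) - W y z| * ‖covD T U μ (Ψ y) z‖ ^ 2
          ≤ g₁ * ‖covDstar T U μ (Ψ y) z‖ ^ 2 + g₁ * ‖covD T U μ (Ψ y) z‖ ^ 2 :=
            add_le_add (mul_le_mul_of_nonneg_right a1 (sq_nonneg _)) (mul_le_mul_of_nonneg_right a2 (sq_nonneg _))
        _ = g₁ * (‖covDstar T U μ (Ψ y) z‖ ^ 2 + ‖covD T U μ (Ψ y) z‖ ^ 2) := by ring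
    · obtain ⟨h0, hp, hm⟩ := hN y z hn
      rw [if_neg hn, mul_zero]
      refine le_of_eq (Finset.sum_eq_zero fun μ _ => ?_)
      rw [h0, hp μ, hm μ]; simp

end Main

end Summit.QuantumFields.YangMills.Theorems.Prop7LocalModelBlend

end
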